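import Summits.HubbardSuperconductivity.HubbardSuperconductivity.Theorems.AnisotropyChordTransferFibre3FinX3Eval

/-!
# Route `AnisotropyChord` / H0 rotor rung: FIN per-`L` GM₃ (X5), `L = 26` — rows `N₁` / D / side-condition cell facts, part `p55`

Kernel facts (`decide +kernel`) for cert cells 129, 130 of the per-`L` grid of `L = 26`: `xbnCellAny2` (row `N₁` on XB2 point wedges recomputed in the kernel, exporting the literal brackets `nt ⊇ T⁺ − 3λ₂` and `tb ⊇ T⁺·D`), `xdCellAnyN0` (row D, reads `nt`), `sdCellAnyZN` (side condition, reads `nt`); evaluators `…FinX3Eval` / `…FinX5Eval`; constants from the compiled design probe (x3probe/x3plan, margins c ×0.985, b ×1.03, aD ×1.03); assembled in `…FinX5GM3TwentySix`.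
Prover seat `hubbard-h0-rotor-p3` g8; helper for piece A = stmt-HubbardSuperconductivity-23918 of rung 19089 (`--supports`, helper class).
WHAT THIS IS NOT: nothing here proves superconductivity in the Hubbard model (rotor TARGET as worded stays FALSE, g15 verdict); kernel facts for the FIN certificate of ONE conditional reduction.  Tree imports only; zero data; standard axioms.
-/

set_option linter.dupNamespace false
set_option autoImplicit false

namespace Summit.HubbardSuperconductivity.HubbardSuperconductivity.Theorems.AnisotropyChord.Transfer.Fibre3

namespace FinXD

open FinXB FinCell Hole2

set_option maxHeartbeats 4000000 in
/-- row `N₁` of cell 129 of `L = 26` (`c = 113/200`), exporting `nt`, `tb`. [folklore] -/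
theorem xn26_129 : xbnCellAny2 26 (49/50 : ℚ) 1912909065437073 1960731792073000 (113/200 : ℚ) ((35615897013260 : ℤ), (55498746422905 : ℤ)) ((5774308066913369 : ℤ), (5937729149053015 : ℤ)) = true := by decide +kernel

set_option maxHeartbeats 4000000 in
/-- row D of cell 129 of `L = 26` (`aD = 19/250`). [folklore] -/
theorem xd26_129 : xdCellAnyN0 26 (49/50 : ℚ) 1912909065437073 1960731792073000 (19/250 : ℚ) ((35615897013260 : ℤ), (55498746422905 : ℤ)) = true := by decide +kernel

set_option maxHeartbeats 4000000 in
/-- side condition of cell 129 of `L = 26` (`c, b = 113/100, aD`). [folklore] -/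
theorem sd26_129 : sdCellAnyZN 26 (49/50 : ℚ) 100 1912909065437073 1960731792073000 ((113/200 : ℚ), (113 : ℕ), (19/250 : ℚ)) ((35615897013260 : ℤ), (55498746422905 : ℤ)) = true := by decide +kernel

set_option maxHeartbeats 4000000 in
/-- row `N₁` of cell 130 of `L = 26` (`c = 113/200`), exporting `nt`, `tb`. [folklore] -/
theorem xn26_130 : xbnCellAny2 26 (49/50 : ℚ) 1960731792073000 2009750086874825 (113/200 : ℚ) ((38179967961713 : ℤ), (59362743080767 : ℤ)) ((5920339442109325 : ℤ), (6088648905776630 : ℤ)) = true := by decide +kernel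

set_option maxHeartbeats 4000000 in
/-- row D of cell 130 of `L = 26` (`aD = 19/250`). [folklore] -/
theorem xd26_130 : xdCellAnyN0 26 (49/50 : ℚ) 1960731792073000 2009750086874825 (19/250 : ℚ) ((38179967961713 : ℤ), (59362743080767 : ℤ)) = true := by decide +kernel

set_option maxHeartbeats 4000000 in
/-- side condition of cell 130 of `L = 26` (`c, b = 116/100, aD`). [folklore] -/
theorem sd26_130 : sdCellAnyZN 26 (49/50 : ℚ) 100 1960731792073000 2009750086874825 ((113/200 : ℚ), (116 : ℕ), (19/250 : ℚ)) ((38179967961713 : ℤ), (59362743080767 : ℤ)) = true := by decide +kernel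

end FinXD

end Summit.HubbardSuperconductivity.HubbardSuperconductivity.Theorems.AnisotropyChord.Transfer.Fibre3
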